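import Mathlib
import HarnessLib
import Literature.NumberTheory.LFunctions.HorocycleStripFourier

/-!
# The horocycle integral of a strip test and the decay of its Fourier coefficients

Support file (all statements PROVED, no definitions, no named facts) for the elementary proof of
the unconditional rate `m_F(y) = c + O(y^{1/2})` of equidistribution of closed horocycles on
`SL(2,ℤ)\ℍ` (`Literature.NumberTheory.LFunctions.zagier_sarnak_horocycle_rate_half`; Sarnak 1981,
Thm. 1; Zagier 1981, §1), continuing `HorocycleStripFourier.lean`.

After unfolding the horocycle average of an incomplete Poincaré series over `Γ_∞\Γ/Γ_∞`
(Iwaniec, *Spectral methods*, §3.4), each double coset `c ≥ 1`, `a mod c` contributes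
`y Ψ(c²y, a/c)` with the *horocycle integral*
`Ψ(w, θ) = ∫_ℝ f(θ - 1/(w(t+i))) dt`
of the strip test `f` over the horocycle of euclidean diameter `1/w` tangent to `ℝ` at `θ`
(`θ - 1/(w(t+i)) = θ - t/(w(1+t²)) + i/(w(1+t²))`, `hpt_eq`). This file proves, for a strip test
`f` (`ContDiff ℝ ∞ f`, `f(z+1) = f z`, `f z ≠ 0 → a ≤ im z ≤ b`, `0 < a ≤ b`):

* `Ψ(w, ·)` is continuous and `1`-periodic, and vanishes for `w ≥ 1/a`
  (`continuous_integral_apply_hpt`, `integral_apply_hpt_add_one`,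
  `integral_apply_hpt_eq_zero_of_le`);
* its Fourier coefficients are `∫₀¹ Ψ(w,θ) e(-kθ) dθ = ∫_ℝ e(k X_w(t)) g_k(Y_w(t)) dt` with
  `X_w(t) = -t/(w(1+t²))`, `Y_w(t) = 1/(w(1+t²))`, `g_k(h) = ∫₀¹ f(x+ih) e(-kx) dx`
  (`coeff_integral_apply_hpt`: Fubini and the shift `x = θ + X_w(t)`);
* **uniform decay** `‖∫₀¹ Ψ(w,θ) e(-kθ) dθ‖ ≤ M/|k|³` for all `w > 0`, `k ≠ 0`
  (`exists_norm_coeffPsi_le`): for `w ≥ 1/(3b)` the trivial bound over the support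
  `|t| ≤ √(1/(wa))` (`norm_phase_integral_le_of_ge`); for `w ≤ 1/(3b)` the arc `t² ≤ 2` lies above
  the strip and on each branch `|t| ≥ √2` one integration by parts against the phase
  `e(k X_w(t))` (`norm_branch_integral_le`: with `V = 1/X_w'`, `|Y_w' V| ≤ 6wbt` and
  `|V'| ≤ 6wt` on the support, and `∫₀^{√(1/(wa))} t dt = 1/(2wa)`, the `w`-dependence cancels);
* hence the pointwise Fourier expansion `Ψ(w,θ) = ∑_k (∫₀¹ Ψ(w,·) e(-k·)) e(kθ)`
  (`hasSum_integral_apply_hpt`, `summable_coeffPsi`).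

## References
* H. Iwaniec, *Spectral Methods of Automorphic Forms*, 2nd ed., AMS GSM 53 (2002), §3.4
  [Iwaniec2002].
* P. Sarnak, *Asymptotic behavior of periodic orbits of the horocycle flow and Eisenstein
  series*, Comm. Pure Appl. Math. 34 (1981), 719–739, Thm. 1 [Sarnak1981].

## Mathlib search
`MeasureTheory.integral_integral_swap_of_hasCompactSupport` (Fubini for continuous compactly
supported integrands; the `θ`-integral over `[0,1]` is handled with a `ContDiffBump` equal to `1`
on `[0,1]` and the measure `volume.restrict (Ioc 0 1)`), `Function.Periodic.intervalIntegral_add_eq`,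
`intervalIntegral.integral_mul_deriv_eq_deriv_mul`, `Measure.integral_comp_mul_left`.
-/

noncomputable section

open Complex MeasureTheory Set Filter Topology intervalIntegral
open scoped Real ContDiff

namespace Literature.NumberTheory.LFunctions

namespace HorocyclePhase

open HorocycleStripFourier

variable {f : ℂ → ℂ} {a b : ℝ}

/-! ### The horocycle point `θ - 1/(w(t+i))` -/

/-- `t + i ≠ 0`. [folklore] -/
theorem ofReal_add_I_ne_zero (t : ℝ) : (t : ℂ) + I ≠ 0 := by
  intro h; have := congrArg Complex.im h; simp at this

/-- `1/(w(t+i)) = t/(w(1+t²)) - i/(w(1+t²))`. [folklore] -/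
theorem one_div_mul_add_I {w : ℝ} (hw : w ≠ 0) (t : ℝ) :
    (1 : ℂ) / ((w : ℂ) * ((t : ℂ) + I)) =
      ((t / (w * (1 + t ^ 2)) : ℝ) : ℂ) - ((1 / (w * (1 + t ^ 2)) : ℝ) : ℂ) * I := by
  have hne : (w : ℂ) * ((t : ℂ) + I) ≠ 0 := mul_ne_zero (ofReal_ne_zero.mpr hw) (ofReal_add_I_ne_zero t)
  have ht : (1 + t ^ 2 : ℝ) ≠ 0 := by positivity
  rw [div_eq_iff hne]
  apply Complex.ext
  · simp only [one_re, sub_re, ofReal_re, mul_re, I_re, mul_zero, ofReal_im, I_im, mul_one,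
      sub_self, add_re, add_im, mul_im, zero_add, sub_im, zero_sub, add_zero]
    field_simp
    ring
  · simp only [one_im, sub_im, ofReal_im, mul_im, I_re, mul_zero, ofReal_re, I_im, mul_one,
      zero_add, add_re, add_im, mul_re, sub_re, zero_sub, add_zero]
    field_simp
    ring

/-- The horocycle point in real coordinates:
`θ - 1/(w(t+i)) = (θ - t/(w(1+t²))) + i/(w(1+t²))`. [folklore] -/
theorem hpt_eq {w : ℝ} (hw : w ≠ 0) (θ t : ℝ) :
    (θ : ℂ) - 1 / ((w : ℂ) * ((t : ℂ) + I)) =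
      ((θ - t / (w * (1 + t ^ 2)) : ℝ) : ℂ) + ((1 / (w * (1 + t ^ 2)) : ℝ) : ℂ) * I := by
  rw [one_div_mul_add_I hw t]; push_cast; ring

/-- Height of the horocycle point: `1/(w(1+t²))`. [folklore] -/
theorem hpt_im {w : ℝ} (hw : w ≠ 0) (θ t : ℝ) :
    ((θ : ℂ) - 1 / ((w : ℂ) * ((t : ℂ) + I))).im = 1 / (w * (1 + t ^ 2)) := by
  rw [hpt_eq hw θ t]
  simp only [add_im, ofReal_im, mul_im, ofReal_re, I_im, I_re, mul_one, mul_zero, add_zero,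
    zero_add]

/-- Shifting `θ` by `1` shifts the point by `1`. [folklore] -/
theorem hpt_add_one (w θ t : ℝ) :
    (((θ + 1 : ℝ)) : ℂ) - 1 / ((w : ℂ) * ((t : ℂ) + I)) =
      ((θ : ℂ) - 1 / ((w : ℂ) * ((t : ℂ) + I))) + 1 := by
  push_cast; ring

/-- Joint continuity of the horocycle point in `(θ, t)`. [folklore] -/
theorem continuous_hpt {w : ℝ} (hw : w ≠ 0) :
    Continuous fun p : ℝ × ℝ => (p.1 : ℂ) - 1 / ((w : ℂ) * ((p.2 : ℂ) + I)) := by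
  refine Continuous.sub (by fun_prop) (Continuous.div continuous_const (by fun_prop) fun p => ?_)
  exact mul_ne_zero (ofReal_ne_zero.mpr hw) (ofReal_add_I_ne_zero _)

/-- Continuity of the horocycle point in `t`. [folklore] -/
theorem continuous_hpt_right {w : ℝ} (hw : w ≠ 0) (θ : ℝ) :
    Continuous fun t : ℝ => (θ : ℂ) - 1 / ((w : ℂ) * ((t : ℂ) + I)) :=
  (continuous_hpt hw).comp (Continuous.prodMk_right θ)

/-! ### Support of the integrand along the horocycle -/

/-- On the support of `t ↦ f(θ - 1/(w(t+i)))`: `1/(wb) < 1 + t² < 1/(wa)`. [folklore] -/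
theorem one_add_sq_mem (hfc : Continuous f) (hsupp : ∀ z, f z ≠ 0 → a ≤ z.im ∧ z.im ≤ b)
    (ha : 0 < a) {w : ℝ} (hw : 0 < w) {θ t : ℝ}
    (h : f ((θ : ℂ) - 1 / ((w : ℂ) * ((t : ℂ) + I))) ≠ 0) :
    1 / (w * b) < 1 + t ^ 2 ∧ 1 + t ^ 2 < 1 / (w * a) := by
  have h12 := im_mem_Ioo_of_ne_zero hfc hsupp h
  rw [hpt_im hw.ne' θ t] at h12
  obtain ⟨h1, h2⟩ := h12
  have hpos : 0 < w * (1 + t ^ 2) := by positivity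
  have hb : 0 < b := ha.trans (h1.trans h2)
  rw [lt_div_iff₀ hpos] at h1
  rw [div_lt_iff₀ hpos] at h2
  constructor
  · rw [div_lt_iff₀ (mul_pos hw hb)]; nlinarith
  · rw [lt_div_iff₀ (mul_pos hw ha)]; nlinarith

/-- … hence `|t| < √(1/(wa))`. [folklore] -/
theorem abs_lt_sqrt_of_ne_zero (hfc : Continuous f) (hsupp : ∀ z, f z ≠ 0 → a ≤ z.im ∧ z.im ≤ b)
    (ha : 0 < a) {w : ℝ} (hw : 0 < w) {θ t : ℝ}
    (h : f ((θ : ℂ) - 1 / ((w : ℂ) * ((t : ℂ) + I))) ≠ 0) : |t| < Real.sqrt (1 / (w * a)) := by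
  have := (one_add_sq_mem hfc hsupp ha hw h).2
  rw [← Real.sqrt_sq_eq_abs]
  exact Real.sqrt_lt_sqrt (sq_nonneg t) (by nlinarith)

/-- For `w ≥ 1/a` the horocycle of diameter `1/w` stays below the strip: the integrand vanishes
identically. [folklore] -/
theorem apply_hpt_eq_zero_of_le (hfc : Continuous f) (hsupp : ∀ z, f z ≠ 0 → a ≤ z.im ∧ z.im ≤ b)
    (ha : 0 < a) {w : ℝ} (hw : 1 / a ≤ w) (θ t : ℝ) :
    f ((θ : ℂ) - 1 / ((w : ℂ) * ((t : ℂ) + I))) = 0 := by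
  have hw0 : 0 < w := lt_of_lt_of_le (by positivity) hw
  by_contra h
  have h2 := (one_add_sq_mem hfc hsupp ha hw0 h).2
  have : 1 / (w * a) ≤ 1 := by
    rw [div_le_one (mul_pos hw0 ha)]
    calc (1:ℝ) = 1 / a * a := by field_simp
      _ ≤ w * a := by gcongr
  nlinarith [sq_nonneg t]

/-- For `0 < w ≤ 1/(3b)` the integrand vanishes for `t² ≤ 2` (the top of the horocycle is above
the strip). [folklore] -/
theorem apply_hpt_eq_zero_of_sq_le_two (hfc : Continuous f)
    (hsupp : ∀ z, f z ≠ 0 → a ≤ z.im ∧ z.im ≤ b) (ha : 0 < a) {w : ℝ} (hw : 0 < w)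
    (hwb : w ≤ 1 / (3 * b)) {θ t : ℝ} (ht : t ^ 2 ≤ 2) :
    f ((θ : ℂ) - 1 / ((w : ℂ) * ((t : ℂ) + I))) = 0 := by
  by_contra h
  have h1 := (one_add_sq_mem hfc hsupp ha hw h).1
  have hb : 0 < b := by
    have := im_mem_Ioo_of_ne_zero hfc hsupp h
    exact ha.trans (this.1.trans this.2)
  have h3 : 3 ≤ 1 / (w * b) := by
    rw [le_div_iff₀ (mul_pos hw hb)]
    calc 3 * (w * b) = w * (3 * b) := by ring
      _ ≤ 1 / (3 * b) * (3 * b) := by gcongr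
      _ = 1 := by field_simp
  linarith

/-- Outside `|t| < √(1/(wa))` the integrand vanishes. [folklore] -/
theorem apply_hpt_eq_zero_of_sqrt_le (hfc : Continuous f)
    (hsupp : ∀ z, f z ≠ 0 → a ≤ z.im ∧ z.im ≤ b) (ha : 0 < a) {w : ℝ} (hw : 0 < w) {θ t : ℝ}
    (ht : Real.sqrt (1 / (w * a)) ≤ |t|) : f ((θ : ℂ) - 1 / ((w : ℂ) * ((t : ℂ) + I))) = 0 := by
  by_contra h
  exact absurd (abs_lt_sqrt_of_ne_zero hfc hsupp ha hw h) (not_lt.mpr ht)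

/-! ### The horocycle integral `Ψ(w,θ) = ∫ f(θ - 1/(w(t+i))) dt` -/

/-- The integrand is continuous in `t`. [folklore] -/
theorem continuous_apply_hpt (hfc : Continuous f) {w : ℝ} (hw : w ≠ 0) (θ : ℝ) :
    Continuous fun t : ℝ => f ((θ : ℂ) - 1 / ((w : ℂ) * ((t : ℂ) + I))) :=
  hfc.comp (continuous_hpt_right hw θ)

/-- The integrand has compact support `⊆ [-√(1/(wa)), √(1/(wa))]`. [folklore] -/
theorem hasCompactSupport_apply_hpt (hfc : Continuous f)
    (hsupp : ∀ z, f z ≠ 0 → a ≤ z.im ∧ z.im ≤ b) (ha : 0 < a) {w : ℝ} (hw : 0 < w) (θ : ℝ) :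
    HasCompactSupport fun t : ℝ => f ((θ : ℂ) - 1 / ((w : ℂ) * ((t : ℂ) + I))) := by
  refine HasCompactSupport.intro (isCompact_Icc (a := -Real.sqrt (1 / (w * a)))
    (b := Real.sqrt (1 / (w * a)))) fun t ht => ?_
  apply apply_hpt_eq_zero_of_sqrt_le hfc hsupp ha hw
  rw [Set.mem_Icc, not_and_or, not_le, not_le] at ht
  rcases ht with ht | ht
  · rw [abs_of_neg (by linarith [Real.sqrt_nonneg (1 / (w * a))])]; linarith
  · rw [abs_of_pos (by linarith [Real.sqrt_nonneg (1 / (w * a))])]; linarith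

/-- … hence it is integrable. [folklore] -/
theorem integrable_apply_hpt (hfc : Continuous f)
    (hsupp : ∀ z, f z ≠ 0 → a ≤ z.im ∧ z.im ≤ b) (ha : 0 < a) {w : ℝ} (hw : 0 < w) (θ : ℝ) :
    Integrable fun t : ℝ => f ((θ : ℂ) - 1 / ((w : ℂ) * ((t : ℂ) + I))) :=
  (continuous_apply_hpt hfc hw.ne' θ).integrable_of_hasCompactSupport
    (hasCompactSupport_apply_hpt hfc hsupp ha hw θ)

/-- The horocycle integral as an integral over `[-T, T]` for any `T ≥ √(1/(wa))`. [folklore] -/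
theorem integral_apply_hpt_eq_intervalIntegral (hfc : Continuous f)
    (hsupp : ∀ z, f z ≠ 0 → a ≤ z.im ∧ z.im ≤ b) (ha : 0 < a) {w : ℝ} (hw : 0 < w) (θ : ℝ)
    {T : ℝ} (hT : Real.sqrt (1 / (w * a)) ≤ T) :
    ∫ t : ℝ, f ((θ : ℂ) - 1 / ((w : ℂ) * ((t : ℂ) + I))) =
      ∫ t in (-T)..T, f ((θ : ℂ) - 1 / ((w : ℂ) * ((t : ℂ) + I))) := by
  symm
  apply intervalIntegral.integral_eq_integral_of_support_subset
  intro t ht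
  rw [Function.mem_support] at ht
  have := abs_lt_sqrt_of_ne_zero hfc hsupp ha hw ht
  rw [abs_lt] at this
  exact ⟨by linarith, by linarith⟩

/-- `θ ↦ Ψ(w, θ)` is `1`-periodic. [folklore] -/
theorem integral_apply_hpt_add_one (hper : ∀ z, f (z + 1) = f z) (w θ : ℝ) :
    ∫ t : ℝ, f ((((θ + 1 : ℝ)) : ℂ) - 1 / ((w : ℂ) * ((t : ℂ) + I))) =
      ∫ t : ℝ, f ((θ : ℂ) - 1 / ((w : ℂ) * ((t : ℂ) + I))) := by
  congr 1; ext t; rw [hpt_add_one, hper]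

/-- `θ ↦ Ψ(w, θ)` is continuous. [folklore] -/
theorem continuous_integral_apply_hpt (hfc : Continuous f)
    (hsupp : ∀ z, f z ≠ 0 → a ≤ z.im ∧ z.im ≤ b) (ha : 0 < a) {w : ℝ} (hw : 0 < w) :
    Continuous fun θ : ℝ => ∫ t : ℝ, f ((θ : ℂ) - 1 / ((w : ℂ) * ((t : ℂ) + I))) := by
  have e : (fun θ : ℝ => ∫ t : ℝ, f ((θ : ℂ) - 1 / ((w : ℂ) * ((t : ℂ) + I)))) = fun θ : ℝ =>
      ∫ t in (-Real.sqrt (1 / (w * a)))..Real.sqrt (1 / (w * a)),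
        f ((θ : ℂ) - 1 / ((w : ℂ) * ((t : ℂ) + I))) := by
    ext θ; exact integral_apply_hpt_eq_intervalIntegral hfc hsupp ha hw θ le_rfl
  rw [e]
  refine intervalIntegral.continuous_parametric_intervalIntegral_of_continuous' ?_ _ _
  exact hfc.comp (continuous_hpt hw.ne')


/-! ### The Fourier coefficients of `θ ↦ Ψ(w, θ)` -/

/-- The inner `θ`-integral: for fixed `t`,
`∫₀¹ f(θ - 1/(w(t+i))) e(-kθ) dθ = e(k X) ∫₀¹ f(x + iY) e(-kx) dx`, `X = -t/(w(1+t²))`,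
`Y = 1/(w(1+t²))` (shift `x = θ + X` and `1`-periodicity). [folklore] -/
theorem inner_integral_eq (hper : ∀ z, f (z + 1) = f z) {w : ℝ} (hw : w ≠ 0) (k : ℤ) (t : ℝ) :
    ∫ θ in (0:ℝ)..1, f ((θ : ℂ) - 1 / ((w : ℂ) * ((t : ℂ) + I))) *
        Complex.exp (-(2 * π * I * k * θ)) =
      Complex.exp (2 * π * I * k * (-t / (w * (1 + t ^ 2)))) *
        ∫ x in (0:ℝ)..1, f (x + (1 / (w * (1 + t ^ 2)) : ℝ) * I) *
          Complex.exp (-(2 * π * I * k * x)) := by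
  set c : ℝ := t / (w * (1 + t ^ 2)) with hc
  set Y : ℝ := 1 / (w * (1 + t ^ 2)) with hY
  set H : ℝ → ℂ := fun x => f (x + (Y : ℂ) * I) * Complex.exp (-(2 * π * I * k * x)) with hH
  have hHp : Function.Periodic H 1 := by
    intro x
    simp only [hH]
    rw [show ((x + 1 : ℝ) : ℂ) + (Y : ℂ) * I = ((x : ℂ) + (Y : ℂ) * I) + 1 by push_cast; ring, hper]
    congr 1
    rw [Complex.exp_eq_exp_iff_exists_int]
    exact ⟨-k, by push_cast; ring⟩
  have hint : ∀ θ : ℝ, f ((θ : ℂ) - 1 / ((w : ℂ) * ((t : ℂ) + I))) *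
      Complex.exp (-(2 * π * I * k * θ)) =
      H (θ - c) * Complex.exp (-(2 * π * I * k * c)) := by
    intro θ
    have e1 : f ((θ : ℂ) - 1 / ((w : ℂ) * ((t : ℂ) + I))) = f (((θ - c : ℝ) : ℂ) + (Y : ℂ) * I) := by
      rw [hpt_eq hw θ t]
    have e2 : Complex.exp (-(2 * π * I * k * θ)) =
        Complex.exp (-(2 * π * I * k * ((θ - c : ℝ) : ℂ))) * Complex.exp (-(2 * π * I * k * c)) := by
      rw [← Complex.exp_add]; congr 1; push_cast; ring
    rw [e1, e2]
    simp only [hH]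
    ring
  simp_rw [hint]
  rw [intervalIntegral.integral_mul_const, intervalIntegral.integral_comp_sub_right H c,
    show (0 : ℝ) - c = -c by ring, show (1 : ℝ) - c = -c + 1 by ring,
    hHp.intervalIntegral_add_eq (-c) 0, zero_add, mul_comm]
  congr 1
  rw [hc]
  congr 1
  push_cast
  ring

/-- **Fourier coefficients of the horocycle integral.** For a strip test `f`, `w > 0`, `k ∈ ℤ`:
`∫₀¹ Ψ(w,θ) e(-kθ) dθ = ∫_ℝ e(k X_w(t)) g_k(Y_w(t)) dt` with `Ψ(w,θ) = ∫_ℝ f(θ - 1/(w(t+i))) dt`,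
`X_w(t) = -t/(w(1+t²))`, `Y_w(t) = 1/(w(1+t²))`, `g_k(h) = ∫₀¹ f(x+ih) e(-kx) dx`
(Fubini over `[0,1] × ℝ`, the integrand being continuous and compactly supported in `t`, then
the shift `x = θ + X_w(t)`; Iwaniec, *Spectral methods*, §3.4). [cite: Iwaniec2002, §3.4] -/
theorem coeff_integral_apply_hpt (hfc : Continuous f) (hper : ∀ z, f (z + 1) = f z)
    (hsupp : ∀ z, f z ≠ 0 → a ≤ z.im ∧ z.im ≤ b) (ha : 0 < a) {w : ℝ} (hw : 0 < w) (k : ℤ) :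
    ∫ θ in (0:ℝ)..1, (∫ t : ℝ, f ((θ : ℂ) - 1 / ((w : ℂ) * ((t : ℂ) + I)))) *
        Complex.exp (-(2 * π * I * k * θ)) =
      ∫ t : ℝ, Complex.exp (2 * π * I * k * (-t / (w * (1 + t ^ 2)))) *
        ∫ x in (0:ℝ)..1, f (x + (1 / (w * (1 + t ^ 2)) : ℝ) * I) *
          Complex.exp (-(2 * π * I * k * x)) := by
  -- the two-variable integrand and a bump in `θ` equal to `1` on `[0, 1]`
  set F : ℝ → ℝ → ℂ := fun θ t =>
    f ((θ : ℂ) - 1 / ((w : ℂ) * ((t : ℂ) + I))) * Complex.exp (-(2 * π * I * k * θ)) with hF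
  let χ : ContDiffBump (1 / 2 : ℝ) := ⟨1 / 2, 1, by norm_num, by norm_num⟩
  set G : ℝ → ℝ → ℂ := fun θ t => ((χ θ : ℝ) : ℂ) * F θ t with hG
  have hχ1 : ∀ θ ∈ Ioc (0:ℝ) 1, (χ θ : ℝ) = 1 := fun θ hθ =>
    χ.one_of_mem_closedBall (by
      rw [Metric.mem_closedBall, Real.dist_eq, abs_le]
      constructor <;> linarith [hθ.1, hθ.2])
  -- Step 1: move the character inside and insert the bump
  have step1 : ∫ θ in (0:ℝ)..1, (∫ t : ℝ, f ((θ : ℂ) - 1 / ((w : ℂ) * ((t : ℂ) + I)))) *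
      Complex.exp (-(2 * π * I * k * θ)) = ∫ θ in Ioc (0:ℝ) 1, ∫ t : ℝ, G θ t := by
    rw [intervalIntegral.integral_of_le zero_le_one]
    refine setIntegral_congr_fun measurableSet_Ioc fun θ hθ => ?_
    simp only [hG, hF, hχ1 θ hθ, ofReal_one, one_mul]
    exact (MeasureTheory.integral_mul_const _ _).symm
  -- Step 2: Fubini for the continuous compactly supported `G`
  have hGc : Continuous (Function.uncurry G) := by
    simp only [hG, hF]
    refine ((Complex.continuous_ofReal.comp (χ.continuous.comp continuous_fst)).mul
      ((hfc.comp (continuous_hpt hw.ne')).mul ?_))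
    fun_prop
  have hGs : HasCompactSupport (Function.uncurry G) := by
    refine HasCompactSupport.intro ((isCompact_Icc (a := -(1:ℝ)) (b := 2)).prod
      (isCompact_Icc (a := -Real.sqrt (1 / (w * a))) (b := Real.sqrt (1 / (w * a))))) ?_
    rintro ⟨θ, t⟩ hθt
    simp only [Function.uncurry_apply_pair, hG, hF]
    rw [Set.mem_prod, not_and_or] at hθt
    rcases hθt with hθ | ht
    · have : (χ θ : ℝ) = 0 := by
        apply χ.zero_of_le_dist
        rw [Real.dist_eq]
        rw [Set.mem_Icc, not_and_or, not_le, not_le] at hθ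
        change (1:ℝ) ≤ |θ - 1 / 2|
        rcases hθ with hθ | hθ
        · rw [abs_of_neg (by linarith)]; linarith
        · rw [abs_of_pos (by linarith)]; linarith
      rw [this]; simp
    · have : f ((θ : ℂ) - 1 / ((w : ℂ) * ((t : ℂ) + I))) = 0 := by
        apply apply_hpt_eq_zero_of_sqrt_le hfc hsupp ha hw
        rw [Set.mem_Icc, not_and_or, not_le, not_le] at ht
        rcases ht with ht | ht
        · rw [abs_of_neg (by linarith [Real.sqrt_nonneg (1 / (w * a))])]; linarith
        · rw [abs_of_pos (by linarith [Real.sqrt_nonneg (1 / (w * a))])]; linarith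
      rw [this]; simp
  have step2 : ∫ θ in Ioc (0:ℝ) 1, ∫ t : ℝ, G θ t = ∫ t : ℝ, ∫ θ in Ioc (0:ℝ) 1, G θ t :=
    integral_integral_swap_of_hasCompactSupport hGc hGs
  -- Step 3: remove the bump and evaluate the inner integral
  have step3 : ∀ t : ℝ, ∫ θ in Ioc (0:ℝ) 1, G θ t =
      Complex.exp (2 * π * I * k * (-t / (w * (1 + t ^ 2)))) *
        ∫ x in (0:ℝ)..1, f (x + (1 / (w * (1 + t ^ 2)) : ℝ) * I) *
          Complex.exp (-(2 * π * I * k * x)) := by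
    intro t
    rw [← inner_integral_eq hper hw.ne' k t, intervalIntegral.integral_of_le zero_le_one]
    refine setIntegral_congr_fun measurableSet_Ioc fun θ hθ => ?_
    simp only [hG, hF, hχ1 θ hθ, ofReal_one, one_mul]
  rw [step1, step2]
  exact integral_congr_ae (ae_of_all _ step3)


/-! ### Calculus of the horocycle parametrisation

`Y(t) = 1/(w(1+t²))` (height), `X(t) = -t/(w(1+t²))` (abscissa, relative to `θ`),
`V(t) = w(1+t²)²/(t²-1) = 1/X'(t)` (for `t² ≠ 1`). -/

/-- `Y' = -2t/(w(1+t²)²)`. [folklore] -/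
theorem hasDerivAt_Y {w : ℝ} (hw : w ≠ 0) (t : ℝ) :
    HasDerivAt (fun t : ℝ => 1 / (w * (1 + t ^ 2))) (-2 * t / (w * (1 + t ^ 2) ^ 2)) t := by
  have h1 : HasDerivAt (fun t : ℝ => w * (1 + t ^ 2)) (w * (2 * t)) t := by
    have := ((hasDerivAt_pow 2 t).const_add 1).const_mul w
    simpa using this
  have ht : (1 + t ^ 2) ≠ 0 := by positivity
  have hne : w * (1 + t ^ 2) ≠ 0 := mul_ne_zero hw ht
  refine ((hasDerivAt_const t (1:ℝ)).div h1 hne).congr_deriv ?_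
  field_simp
  ring

/-- `X' = (t²-1)/(w(1+t²)²)`. [folklore] -/
theorem hasDerivAt_X {w : ℝ} (hw : w ≠ 0) (t : ℝ) :
    HasDerivAt (fun t : ℝ => -t / (w * (1 + t ^ 2))) ((t ^ 2 - 1) / (w * (1 + t ^ 2) ^ 2)) t := by
  have h1 : HasDerivAt (fun t : ℝ => w * (1 + t ^ 2)) (w * (2 * t)) t := by
    have := ((hasDerivAt_pow 2 t).const_add 1).const_mul w
    simpa using this
  have ht : (1 + t ^ 2) ≠ 0 := by positivity
  have hne : w * (1 + t ^ 2) ≠ 0 := mul_ne_zero hw ht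
  refine ((hasDerivAt_neg t).div h1 hne).congr_deriv ?_
  field_simp
  ring

/-- `V' = 2wt(1+t²)(t²-3)/(t²-1)²` for `t² ≠ 1`. [folklore] -/
theorem hasDerivAt_V (w : ℝ) {t : ℝ} (ht : t ^ 2 - 1 ≠ 0) :
    HasDerivAt (fun t : ℝ => w * (1 + t ^ 2) ^ 2 / (t ^ 2 - 1))
      (2 * w * t * (1 + t ^ 2) * (t ^ 2 - 3) / (t ^ 2 - 1) ^ 2) t := by
  have h1 : HasDerivAt (fun t : ℝ => w * (1 + t ^ 2) ^ 2) (w * (2 * (1 + t ^ 2) * (2 * t))) t := by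
    have := (((hasDerivAt_pow 2 t).const_add 1).pow 2).const_mul w
    simpa using this
  have h2 : HasDerivAt (fun t : ℝ => t ^ 2 - 1) (2 * t) t := by
    simpa using (hasDerivAt_pow 2 t).sub_const 1
  refine (h1.div h2 ht).congr_deriv ?_
  field_simp
  ring

/-- `V · X' = 1`. [folklore] -/
theorem V_mul_X' {w : ℝ} (hw : w ≠ 0) {t : ℝ} (ht : t ^ 2 - 1 ≠ 0) :
    w * (1 + t ^ 2) ^ 2 / (t ^ 2 - 1) * ((t ^ 2 - 1) / (w * (1 + t ^ 2) ^ 2)) = 1 := by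
  have : (1 + t ^ 2) ≠ 0 := by positivity
  field_simp

/-- `|Y' V| = 2t/(t²-1) ≤ 6wbt` on the support (`t > 0`, `t² - 1 ≥ 1/(3wb)`). [folklore] -/
theorem abs_Y'_mul_V_le {w b t : ℝ} (hw : 0 < w) (hb : 0 < b) (ht : 0 < t)
    (hts : 1 / (3 * w * b) ≤ t ^ 2 - 1) :
    |(-2 * t / (w * (1 + t ^ 2) ^ 2)) * (w * (1 + t ^ 2) ^ 2 / (t ^ 2 - 1))| ≤ 6 * w * b * t := by
  have h1 : 0 < t ^ 2 - 1 := lt_of_lt_of_le (by positivity) hts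
  have hne : (1 + t ^ 2) ≠ 0 := by positivity
  have e : (-2 * t / (w * (1 + t ^ 2) ^ 2)) * (w * (1 + t ^ 2) ^ 2 / (t ^ 2 - 1)) =
      -(2 * t / (t ^ 2 - 1)) := by
    field_simp
  rw [e, abs_neg, abs_of_pos (by positivity), div_le_iff₀ h1]
  rw [div_le_iff₀ (by positivity)] at hts
  nlinarith

/-- `|V'| ≤ 6wt` for `t² ≥ 2`, `t ≥ 0` (from `(1+s)|s-3| ≤ 3(s-1)²` for `s ≥ 2`). [folklore] -/
theorem abs_V'_le {w t : ℝ} (hw : 0 ≤ w) (ht : 0 ≤ t) (ht2 : 2 ≤ t ^ 2) :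
    |2 * w * t * (1 + t ^ 2) * (t ^ 2 - 3) / (t ^ 2 - 1) ^ 2| ≤ 6 * w * t := by
  have h1 : 0 < t ^ 2 - 1 := by linarith
  have key : (1 + t ^ 2) * |t ^ 2 - 3| ≤ 3 * (t ^ 2 - 1) ^ 2 := by
    rcases le_or_gt (t ^ 2) 3 with h | h
    · rw [abs_of_nonpos (by linarith)]; nlinarith
    · rw [abs_of_pos (by linarith)]; nlinarith
  rw [abs_div, abs_of_pos (by positivity : (0:ℝ) < (t ^ 2 - 1) ^ 2), div_le_iff₀ (by positivity)]
  rw [show 2 * w * t * (1 + t ^ 2) * (t ^ 2 - 3) = (2 * w * t) * ((1 + t ^ 2) * (t ^ 2 - 3)) by ring,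
    abs_mul, abs_of_nonneg (by positivity : (0:ℝ) ≤ 2 * w * t)]
  calc 2 * w * t * |(1 + t ^ 2) * (t ^ 2 - 3)| = 2 * w * t * ((1 + t ^ 2) * |t ^ 2 - 3|) := by
        rw [abs_mul, abs_of_pos (by positivity : (0:ℝ) < 1 + t ^ 2)]
    _ ≤ 2 * w * t * (3 * (t ^ 2 - 1) ^ 2) := by gcongr
    _ = 6 * w * t * (t ^ 2 - 1) ^ 2 := by ring

/-! ### Non-stationary phase on one branch of the horocycle -/

/-- **Branch estimate.** Let `0 < a ≤ b`, `0 < w ≤ 1/(3b)`, `κ ≠ 0`, and let `G` be `C¹` with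
`G' = G₁` continuous, `‖G‖ ≤ S₀`, `‖G₁‖ ≤ S₁`, both supported in `(a, b)`. Then
`‖∫_{√2}^{√(1/(wa))} exp(iκ X(t)) G(Y(t)) dt‖ ≤ 3 (b S₁ + S₀) / (|κ| a)`
(one integration by parts against the phase, `|Y'V| ≤ 6wbt` and `|V'| ≤ 6wt` on the
support, `∫₀^{√(1/(wa))} t dt = 1/(2wa)`). [folklore] -/
theorem norm_branch_integral_le {a b w κ S₀ S₁ : ℝ} {G G₁ : ℝ → ℂ} (ha : 0 < a) (hab : a ≤ b)
    (hw : 0 < w) (hwb : w ≤ 1 / (3 * b)) (hκ : κ ≠ 0) (hG : ∀ h, HasDerivAt G (G₁ h) h)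
    (hG₁c : Continuous G₁) (hS₀ : ∀ h, ‖G h‖ ≤ S₀) (hS₁ : ∀ h, ‖G₁ h‖ ≤ S₁)
    (hGs : ∀ h, G h ≠ 0 → a < h ∧ h < b) (hG₁s : ∀ h, G₁ h ≠ 0 → a < h ∧ h < b) :
    ‖∫ t in Real.sqrt 2..Real.sqrt (1 / (w * a)),
        Complex.exp (I * κ * (-t / (w * (1 + t ^ 2)) : ℝ)) * G (1 / (w * (1 + t ^ 2)))‖ ≤
      3 * (b * S₁ + S₀) / (|κ| * a) := by
  have hb : 0 < b := lt_of_lt_of_le ha hab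
  have hS₀0 : 0 ≤ S₀ := le_trans (norm_nonneg _) (hS₀ 0)
  have hS₁0 : 0 ≤ S₁ := le_trans (norm_nonneg _) (hS₁ 0)
  have hGc : Continuous G := continuous_iff_continuousAt.2 fun h => (hG h).continuousAt
  set T : ℝ := Real.sqrt (1 / (w * a)) with hT
  have hT2 : T ^ 2 = 1 / (w * a) := Real.sq_sqrt (by positivity)
  have hwb3 : 3 ≤ 1 / (w * b) := by
    rw [le_div_iff₀ (mul_pos hw hb)]
    calc 3 * (w * b) = w * (3 * b) := by ring
      _ ≤ 1 / (3 * b) * (3 * b) := by gcongr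
      _ = 1 := by field_simp
  have hwa3 : 3 ≤ 1 / (w * a) := le_trans hwb3 (by gcongr)
  have h2T : Real.sqrt 2 ≤ T := Real.sqrt_le_sqrt (by linarith)
  have hs2 : Real.sqrt 2 ^ 2 = 2 := Real.sq_sqrt (by norm_num)
  have hs2pos : 0 < Real.sqrt 2 := Real.sqrt_pos.mpr (by norm_num)
  -- on the interval: `t ≥ √2`, so `t² ≥ 2`, `t > 0`, `t² - 1 ≠ 0`
  have hI : ∀ t ∈ Set.uIcc (Real.sqrt 2) T, 0 < t ∧ 2 ≤ t ^ 2 := by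
    intro t ht
    rw [Set.uIcc_of_le h2T, Set.mem_Icc] at ht
    refine ⟨lt_of_lt_of_le hs2pos ht.1, ?_⟩
    calc (2:ℝ) = Real.sqrt 2 ^ 2 := hs2.symm
      _ ≤ t ^ 2 := by gcongr; exact ht.1
  -- the players
  set Y : ℝ → ℝ := fun t => 1 / (w * (1 + t ^ 2)) with hY
  set Y' : ℝ → ℝ := fun t => -2 * t / (w * (1 + t ^ 2) ^ 2) with hY'
  set X : ℝ → ℝ := fun t => -t / (w * (1 + t ^ 2)) with hX
  set X' : ℝ → ℝ := fun t => (t ^ 2 - 1) / (w * (1 + t ^ 2) ^ 2) with hX'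
  set V : ℝ → ℝ := fun t => w * (1 + t ^ 2) ^ 2 / (t ^ 2 - 1) with hV
  set V' : ℝ → ℝ := fun t => 2 * w * t * (1 + t ^ 2) * (t ^ 2 - 3) / (t ^ 2 - 1) ^ 2 with hV'
  set v : ℝ → ℂ := fun t => Complex.exp (I * κ * (X t : ℝ)) with hv
  set v' : ℝ → ℂ := fun t => I * κ * (X' t : ℝ) * v t with hv'
  set u : ℝ → ℂ := fun t => G (Y t) * (V t : ℝ) / (I * κ) with hu
  set u' : ℝ → ℂ := fun t => (G₁ (Y t) * (Y' t : ℝ) * (V t : ℝ) + G (Y t) * (V' t : ℝ)) / (I * κ)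
    with hu'
  have hκC : (κ : ℂ) ≠ 0 := ofReal_ne_zero.mpr hκ
  have hIκ : (I * κ : ℂ) ≠ 0 := mul_ne_zero I_ne_zero hκC
  -- derivatives
  have hvd : ∀ t, HasDerivAt v (v' t) t := by
    intro t
    have h1 : HasDerivAt (fun t : ℝ => I * κ * (X t : ℝ)) (I * κ * (X' t : ℝ)) t := by
      exact ((hasDerivAt_X hw.ne' t).ofReal_comp).const_mul (I * κ)
    have := h1.cexp
    simp only [hv, hv']
    convert this using 1
    ring
  have hud : ∀ t ∈ Set.uIcc (Real.sqrt 2) T, HasDerivAt u (u' t) t := by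
    intro t ht
    obtain ⟨ht0, ht2⟩ := hI t ht
    have hne : t ^ 2 - 1 ≠ 0 := by linarith
    have h1 : HasDerivAt (fun t => G (Y t)) (G₁ (Y t) * (Y' t : ℝ)) t := by
      have := (hG (Y t)).scomp t (hasDerivAt_Y hw.ne' t)
      refine this.congr_deriv ?_
      rw [Complex.real_smul, mul_comm]
    have h2 : HasDerivAt (fun t => ((V t : ℝ) : ℂ)) ((V' t : ℝ) : ℂ) t :=
      (hasDerivAt_V w hne).ofReal_comp
    exact (h1.mul h2).div_const (I * κ)
  -- continuity on the interval (for interval integrability)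
  have hcont : ContinuousOn u' (Set.uIcc (Real.sqrt 2) T) := by
    intro t ht
    obtain ⟨ht0, ht2⟩ := hI t ht
    have hne : t ^ 2 - 1 ≠ 0 := by linarith
    have hYc : Continuous Y := by
      simp only [hY]
      exact continuous_const.div (by fun_prop) fun t => by positivity
    have hY'c : Continuous Y' := by
      simp only [hY']
      exact Continuous.div (by fun_prop) (by fun_prop) fun t => by positivity
    have hVc : ContinuousAt V t := by
      simp only [hV]
      exact ContinuousAt.div (by fun_prop) (by fun_prop) hne
    have hV'c : ContinuousAt V' t := by
      simp only [hV']
      exact ContinuousAt.div (by fun_prop) (by fun_prop) (by positivity)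
    simp only [hu']
    apply ContinuousAt.continuousWithinAt
    refine ContinuousAt.div_const (ContinuousAt.add ?_ ?_) _
    · exact ((hG₁c.continuousAt.comp hYc.continuousAt).mul
        (continuous_ofReal.continuousAt.comp hY'c.continuousAt)).mul
        (continuous_ofReal.continuousAt.comp hVc)
    · exact (hGc.continuousAt.comp hYc.continuousAt).mul
        (continuous_ofReal.continuousAt.comp hV'c)
  have hv'c : Continuous v' := by
    simp only [hv', hv, hX, hX']
    refine Continuous.mul (Continuous.mul continuous_const (continuous_ofReal.comp ?_)) ?_
    · exact Continuous.div (by fun_prop) (by fun_prop) fun t => by positivity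
    · refine Continuous.cexp (Continuous.mul continuous_const (continuous_ofReal.comp ?_))
      exact Continuous.div (by fun_prop) (by fun_prop) fun t => by positivity
  -- the integrand is `u v'`
  have hprod : ∀ t ∈ Set.uIcc (Real.sqrt 2) T,
      Complex.exp (I * κ * (-t / (w * (1 + t ^ 2)) : ℝ)) * G (1 / (w * (1 + t ^ 2))) =
        u t * v' t := by
    intro t ht
    obtain ⟨ht0, ht2⟩ := hI t ht
    have hne : t ^ 2 - 1 ≠ 0 := by linarith
    have key : ((V t : ℝ) : ℂ) * ((X' t : ℝ) : ℂ) = 1 := by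
      rw [← ofReal_mul, V_mul_X' hw.ne' hne, ofReal_one]
    have e : u t * v' t = G (Y t) * v t * (((V t : ℝ) : ℂ) * ((X' t : ℝ) : ℂ)) := by
      simp only [hu, hv']
      field_simp
    rw [e, key, mul_one]
    simp only [hv, hX, hY]
    ring
  -- boundary values vanish
  have hYT : Y T < a := by
    simp only [hY]
    rw [hT2, div_lt_iff₀ (by positivity)]
    have : w * (1 + 1 / (w * a)) = w + 1 / a := by field_simp
    rw [this]
    have : a * (1 / a) = 1 := by field_simp
    nlinarith
  have hY2 : b ≤ Y (Real.sqrt 2) := by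
    simp only [hY]
    rw [hs2, le_div_iff₀ (by positivity)]
    rw [le_div_iff₀ (by positivity)] at hwb3
    linarith
  have huT : u T = 0 := by
    simp only [hu]
    have : G (Y T) = 0 := by
      by_contra h; exact absurd (hGs _ h).1 (not_lt.mpr hYT.le)
    rw [this]; simp
  have hu2 : u (Real.sqrt 2) = 0 := by
    simp only [hu]
    have : G (Y (Real.sqrt 2)) = 0 := by
      by_contra h; exact absurd (hGs _ h).2 (not_lt.mpr hY2)
    rw [this]; simp
  -- integrate by parts
  have hibp := intervalIntegral.integral_mul_deriv_eq_deriv_mul (a := Real.sqrt 2) (b := T)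
    (u := u) (v := v) (u' := u') (v' := v') hud (fun t _ => hvd t)
    (hcont.intervalIntegrable) (hv'c.intervalIntegrable _ _)
  rw [intervalIntegral.integral_congr hprod, hibp, huT, hu2, zero_mul, zero_mul, sub_zero,
    zero_sub, norm_neg]
  -- pointwise bound on `u' v`
  have hvn : ∀ t, ‖v t‖ = 1 := fun t => by
    simp only [hv]
    rw [Complex.norm_exp]
    simp
  have hbound : ∀ t ∈ Set.Ioc (Real.sqrt 2) T,
      ‖u' t * v t‖ ≤ 6 * w * (b * S₁ + S₀) / |κ| * t := by
    intro t ht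
    obtain ⟨ht0, ht2⟩ := hI t (by rw [Set.uIcc_of_le h2T]; exact Set.Ioc_subset_Icc_self ht)
    have hne : t ^ 2 - 1 ≠ 0 := by linarith
    rw [norm_mul, hvn, mul_one]
    simp only [hu']
    rw [norm_div, norm_mul, Complex.norm_I, one_mul, Complex.norm_real, Real.norm_eq_abs]
    rw [div_le_iff₀ (abs_pos.mpr hκ)]
    have hA : ‖G₁ (Y t) * (Y' t : ℝ) * (V t : ℝ)‖ ≤ S₁ * (6 * w * b * t) := by
      by_cases h0 : G₁ (Y t) = 0
      · rw [h0, zero_mul, zero_mul, norm_zero]; positivity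
      · obtain ⟨-, hlt⟩ := hG₁s _ h0
        -- `Y t < b` gives `1 + t² > 1/(wb) ≥ 3`, whence `t² - 1 ≥ 1/(3wb)`
        have h1 : 1 / (w * b) < 1 + t ^ 2 := by
          simp only [hY] at hlt
          rw [div_lt_iff₀ (by positivity)] at hlt
          rw [div_lt_iff₀ (by positivity)]
          nlinarith
        have hts : 1 / (3 * w * b) ≤ t ^ 2 - 1 := by
          rw [div_le_iff₀ (by positivity)]
          rw [div_lt_iff₀ (by positivity)] at h1
          rw [le_div_iff₀ (by positivity)] at hwb3
          nlinarith
        rw [mul_assoc, norm_mul, ← ofReal_mul, Complex.norm_real, Real.norm_eq_abs]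
        exact mul_le_mul (hS₁ _) (abs_Y'_mul_V_le hw hb ht0 hts) (abs_nonneg _) hS₁0
    have hB : ‖G (Y t) * (V' t : ℝ)‖ ≤ S₀ * (6 * w * t) := by
      rw [norm_mul, Complex.norm_real, Real.norm_eq_abs]
      exact mul_le_mul (hS₀ _) (abs_V'_le hw.le ht0.le ht2) (abs_nonneg _) hS₀0
    calc ‖G₁ (Y t) * (Y' t : ℝ) * (V t : ℝ) + G (Y t) * (V' t : ℝ)‖
        ≤ S₁ * (6 * w * b * t) + S₀ * (6 * w * t) := (norm_add_le _ _).trans (add_le_add hA hB)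
      _ = 6 * w * (b * S₁ + S₀) / |κ| * t * |κ| := by field_simp
  -- integrate the bound
  have hle := intervalIntegral.norm_integral_le_of_norm_le h2T (ae_of_all volume hbound)
    ((by fun_prop : Continuous fun t : ℝ => 6 * w * (b * S₁ + S₀) / |κ| * t).intervalIntegrable
      _ _)
  refine hle.trans ?_
  rw [intervalIntegral.integral_const_mul, integral_id, hT2, hs2]
  have e : 6 * w * (b * S₁ + S₀) / |κ| * ((1 / (w * a) - 2) / 2) =
      3 * (b * S₁ + S₀) / (|κ| * a) - 6 * w * (b * S₁ + S₀) / |κ| := by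
    field_simp
    ring
  rw [e]
  have : 0 ≤ 6 * w * (b * S₁ + S₀) / |κ| := by positivity
  linarith


/-! ### The full phase integral `∫_ℝ e(k X(t)) G(Y(t)) dt` -/

/-- Continuity of the phase integrand. [folklore] -/
theorem continuous_phase_integrand {w : ℝ} (hw : w ≠ 0) (k : ℤ) {G : ℝ → ℂ} (hGc : Continuous G) :
    Continuous fun t : ℝ => Complex.exp (2 * π * I * k * (-t / (w * (1 + t ^ 2)))) *
      G (1 / (w * (1 + t ^ 2))) := by
  refine Continuous.mul (Continuous.cexp ?_) (hGc.comp ?_)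
  · refine Continuous.mul continuous_const (Continuous.div (by fun_prop) (by fun_prop) fun t => ?_)
    exact mul_ne_zero (ofReal_ne_zero.mpr hw) (by norm_cast; positivity)
  · exact continuous_const.div (by fun_prop) fun t => mul_ne_zero hw (by positivity)

/-- Support of the phase integrand: `G(Y(t)) ≠ 0` forces `|t| < √(1/(wa))`. [folklore] -/
theorem abs_lt_sqrt_of_apply_Y_ne_zero {a b w : ℝ} (ha : 0 < a) (hw : 0 < w) {G : ℝ → ℂ}
    (hGs : ∀ h, G h ≠ 0 → a < h ∧ h < b) {t : ℝ} (h : G (1 / (w * (1 + t ^ 2))) ≠ 0) :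
    |t| < Real.sqrt (1 / (w * a)) := by
  have h1 := (hGs _ h).1
  rw [lt_div_iff₀ (by positivity)] at h1
  rw [← Real.sqrt_sq_eq_abs]
  refine Real.sqrt_lt_sqrt (sq_nonneg t) ?_
  rw [lt_div_iff₀ (by positivity)]
  nlinarith

/-- The phase integral lives on `[-√(1/(wa)), √(1/(wa))]`. [folklore] -/
theorem phase_integral_eq_intervalIntegral {a b w : ℝ} (ha : 0 < a) (hw : 0 < w) (k : ℤ)
    {G : ℝ → ℂ} (hGs : ∀ h, G h ≠ 0 → a < h ∧ h < b) :
    ∫ t : ℝ, Complex.exp (2 * π * I * k * (-t / (w * (1 + t ^ 2)))) * G (1 / (w * (1 + t ^ 2))) =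
      ∫ t in (-Real.sqrt (1 / (w * a)))..Real.sqrt (1 / (w * a)),
        Complex.exp (2 * π * I * k * (-t / (w * (1 + t ^ 2)))) * G (1 / (w * (1 + t ^ 2))) := by
  symm
  apply intervalIntegral.integral_eq_integral_of_support_subset
  intro t ht
  rw [Function.mem_support] at ht
  have hG : G (1 / (w * (1 + t ^ 2))) ≠ 0 := fun h => ht (by rw [h, mul_zero])
  have := abs_lt_sqrt_of_apply_Y_ne_zero ha hw hGs hG
  rw [abs_lt] at this
  exact ⟨this.1, this.2.le⟩

/-- **Phase integral, small diameter** (`0 < w ≤ 1/(3b)`): both branches `|t| ≥ √2` by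
`norm_branch_integral_le`, the arc `t² ≤ 2` lying above the strip:
`‖∫_ℝ e(kX(t)) G(Y(t)) dt‖ ≤ 6 (b S₁ + S₀) / (2π|k| a)`. [folklore] -/
theorem norm_phase_integral_le_of_le {a b w S₀ S₁ : ℝ} {k : ℤ} {G G₁ : ℝ → ℂ} (ha : 0 < a)
    (hab : a ≤ b) (hw : 0 < w) (hwb : w ≤ 1 / (3 * b)) (hk : k ≠ 0)
    (hG : ∀ h, HasDerivAt G (G₁ h) h) (hG₁c : Continuous G₁) (hS₀ : ∀ h, ‖G h‖ ≤ S₀)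
    (hS₁ : ∀ h, ‖G₁ h‖ ≤ S₁) (hGs : ∀ h, G h ≠ 0 → a < h ∧ h < b)
    (hG₁s : ∀ h, G₁ h ≠ 0 → a < h ∧ h < b) :
    ‖∫ t : ℝ, Complex.exp (2 * π * I * k * (-t / (w * (1 + t ^ 2)))) * G (1 / (w * (1 + t ^ 2)))‖ ≤
      6 * (b * S₁ + S₀) / (2 * π * |(k : ℝ)| * a) := by
  have hb : 0 < b := lt_of_lt_of_le ha hab
  have hGc : Continuous G := continuous_iff_continuousAt.2 fun h => (hG h).continuousAt
  set T : ℝ := Real.sqrt (1 / (w * a)) with hT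
  set Φ : ℝ → ℂ := fun t => Complex.exp (2 * π * I * k * (-t / (w * (1 + t ^ 2)))) *
    G (1 / (w * (1 + t ^ 2))) with hΦ
  have hΦc : Continuous Φ := continuous_phase_integrand hw.ne' k hGc
  have hwb3 : 3 ≤ 1 / (w * b) := by
    rw [le_div_iff₀ (mul_pos hw hb)]
    calc 3 * (w * b) = w * (3 * b) := by ring
      _ ≤ 1 / (3 * b) * (3 * b) := by gcongr
      _ = 1 := by field_simp
  have hwa3 : 3 ≤ 1 / (w * a) := le_trans hwb3 (by gcongr)
  have h2T : Real.sqrt 2 ≤ T := Real.sqrt_le_sqrt (by linarith)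
  have hs2 : Real.sqrt 2 ^ 2 = 2 := Real.sq_sqrt (by norm_num)
  -- split `[-T, T] = [-T, -√2] ∪ [-√2, √2] ∪ [√2, T]`
  rw [phase_integral_eq_intervalIntegral ha hw k hGs]
  change ‖∫ t in (-T)..T, Φ t‖ ≤ _
  have hsplit : ∫ t in (-T)..T, Φ t = (∫ t in (-T)..(-Real.sqrt 2), Φ t) +
      (∫ t in (-Real.sqrt 2)..Real.sqrt 2, Φ t) + ∫ t in Real.sqrt 2..T, Φ t := by
    rw [intervalIntegral.integral_add_adjacent_intervals (hΦc.intervalIntegrable _ _)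
      (hΦc.intervalIntegrable _ _), intervalIntegral.integral_add_adjacent_intervals
      (hΦc.intervalIntegrable _ _) (hΦc.intervalIntegrable _ _)]
  -- the middle arc vanishes
  have hmid : ∫ t in (-Real.sqrt 2)..Real.sqrt 2, Φ t = 0 := by
    rw [intervalIntegral.integral_congr (g := fun _ => (0:ℂ)) fun t ht => ?_]
    · simp
    · rw [Set.uIcc_of_le (by linarith [Real.sqrt_nonneg 2]), Set.mem_Icc, ← abs_le] at ht
      have ht2 : t ^ 2 ≤ 2 := by
        calc t ^ 2 = |t| ^ 2 := (sq_abs t).symm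
          _ ≤ Real.sqrt 2 ^ 2 := by gcongr
          _ = 2 := hs2
      have hYb : b ≤ 1 / (w * (1 + t ^ 2)) := by
        rw [le_div_iff₀ (by positivity)]
        rw [le_div_iff₀ (by positivity)] at hwb3
        nlinarith
      simp only [hΦ]
      have : G (1 / (w * (1 + t ^ 2))) = 0 := by
        by_contra h; exact absurd (hGs _ h).2 (not_lt.mpr hYb)
      rw [this, mul_zero]
  -- the left branch is the right branch with the opposite phase
  have hleft : ∫ t in (-T)..(-Real.sqrt 2), Φ t = ∫ s in Real.sqrt 2..T,
      Complex.exp (I * ((-(2 * π * k) : ℝ)) * (-s / (w * (1 + s ^ 2)) : ℝ)) *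
        G (1 / (w * (1 + s ^ 2))) := by
    rw [← intervalIntegral.integral_comp_neg]
    refine intervalIntegral.integral_congr fun s _ => ?_
    simp only [hΦ]
    congr 1
    · congr 1; push_cast; ring
    · ring_nf
  have hright : ∫ t in Real.sqrt 2..T, Φ t = ∫ s in Real.sqrt 2..T,
      Complex.exp (I * ((2 * π * k : ℝ)) * (-s / (w * (1 + s ^ 2)) : ℝ)) *
        G (1 / (w * (1 + s ^ 2))) := by
    refine intervalIntegral.integral_congr fun s _ => ?_
    simp only [hΦ]
    congr 2; push_cast; ring
  have hκ : (2 * π * k : ℝ) ≠ 0 := by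
    simp [Real.pi_ne_zero, hk]
  have hκ' : (-(2 * π * k) : ℝ) ≠ 0 := neg_ne_zero.mpr hκ
  have hb1 := norm_branch_integral_le ha hab hw hwb hκ hG hG₁c hS₀ hS₁ hGs hG₁s
  have hb2 := norm_branch_integral_le ha hab hw hwb hκ' hG hG₁c hS₀ hS₁ hGs hG₁s
  rw [hsplit, hmid, add_zero, hleft, hright]
  refine (norm_add_le _ _).trans ?_
  have habs : |(2 * π * k : ℝ)| = 2 * π * |(k : ℝ)| := by
    rw [abs_mul, abs_of_pos Real.two_pi_pos]
  rw [abs_neg, habs] at hb2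
  rw [habs] at hb1
  calc _ ≤ 3 * (b * S₁ + S₀) / (2 * π * |(k : ℝ)| * a) + 3 * (b * S₁ + S₀) / (2 * π * |(k : ℝ)| * a) :=
        add_le_add hb2 hb1
    _ = 6 * (b * S₁ + S₀) / (2 * π * |(k : ℝ)| * a) := by ring

/-- **Phase integral, large diameter** (`w ≥ 1/(3b)`): the trivial bound over the support,
`‖∫_ℝ e(kX(t)) G(Y(t)) dt‖ ≤ 2 √(3b/a) S₀`. [folklore] -/
theorem norm_phase_integral_le_of_ge {a b w S₀ : ℝ} (k : ℤ) {G : ℝ → ℂ} (ha : 0 < a) (hab : a ≤ b)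
    (hw : 0 < w) (hwb : 1 / (3 * b) ≤ w) (hS₀ : ∀ h, ‖G h‖ ≤ S₀)
    (hGs : ∀ h, G h ≠ 0 → a < h ∧ h < b) :
    ‖∫ t : ℝ, Complex.exp (2 * π * I * k * (-t / (w * (1 + t ^ 2)))) * G (1 / (w * (1 + t ^ 2)))‖ ≤
      2 * Real.sqrt (3 * b / a) * S₀ := by
  have hb : 0 < b := lt_of_lt_of_le ha hab
  have hS₀0 : 0 ≤ S₀ := le_trans (norm_nonneg _) (hS₀ 0)
  set T : ℝ := Real.sqrt (1 / (w * a)) with hT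
  have hT0 : 0 ≤ T := Real.sqrt_nonneg _
  have hTle : T ≤ Real.sqrt (3 * b / a) := by
    apply Real.sqrt_le_sqrt
    rw [div_le_div_iff₀ (by positivity) ha]
    have h1 : 1 ≤ 3 * b * w := by
      rw [div_le_iff₀ (by positivity)] at hwb; linarith
    nlinarith
  rw [phase_integral_eq_intervalIntegral ha hw k hGs]
  have hle := intervalIntegral.norm_integral_le_of_norm_le_const (a := -T) (b := T) (C := S₀)
    (f := fun t => Complex.exp (2 * π * I * k * (-t / (w * (1 + t ^ 2)))) * G (1 / (w * (1 + t ^ 2))))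
    (fun t _ => by
      rw [norm_mul]
      have e : (2 * π * I * k * (-t / (w * (1 + t ^ 2)) : ℂ)) =
          ((2 * π * k * (-t / (w * (1 + t ^ 2))) : ℝ) : ℂ) * I := by push_cast; ring
      rw [e, Complex.norm_exp_ofReal_mul_I, one_mul]
      exact hS₀ _)
  refine hle.trans ?_
  rw [show T - -T = 2 * T by ring, abs_of_nonneg (by positivity)]
  calc S₀ * (2 * T) = 2 * T * S₀ := by ring
    _ ≤ 2 * Real.sqrt (3 * b / a) * S₀ := by gcongr


/-! ### Decay of the Fourier coefficients of `Ψ(w, ·)`, uniformly in `w` -/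

/-- Coefficients along horizontal lines vanish unless `a < h < b`. [folklore] -/
theorem coeff_support (hfc : Continuous f) (hsupp : ∀ z, f z ≠ 0 → a ≤ z.im ∧ z.im ≤ b) (k : ℤ)
    (h : ℝ) (hne : (∫ x in (0:ℝ)..1, f (x + h * I) * Complex.exp (-(2 * π * I * k * x))) ≠ 0) :
    a < h ∧ h < b := by
  by_contra hcon
  apply hne
  have h0 : ∀ x : ℝ, f (x + h * I) = 0 := fun x => by
    by_contra hx
    have := im_mem_Ioo_of_ne_zero hfc hsupp hx
    simp only [add_im, ofReal_im, mul_im, ofReal_re, I_im, mul_one, I_re, mul_zero, add_zero,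
      zero_add] at this
    exact hcon this
  simp [h0]

/-- **Uniform decay of the Fourier coefficients of the horocycle integral.** For a strip test
`f` (`0 < a ≤ b`) there is `M` with `‖∫₀¹ Ψ(w,θ) e(-kθ) dθ‖ ≤ M/|k|³` for all `w > 0` and
`k ≠ 0` — the non-stationary phase bound for `w ≤ 1/(3b)` and the trivial bound for
`w ≥ 1/(3b)`, fed with `‖g_k‖, ‖∂_h g_k‖ ≤ C/|k|³`. [folklore] -/
theorem exists_norm_coeffPsi_le (hf : ContDiff ℝ ∞ f) (hper : ∀ z, f (z + 1) = f z)
    (hsupp : ∀ z, f z ≠ 0 → a ≤ z.im ∧ z.im ≤ b) (ha : 0 < a) (hab : a ≤ b) :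
    ∃ M : ℝ, 0 ≤ M ∧ ∀ (w : ℝ), 0 < w → ∀ (k : ℤ), k ≠ 0 →
      ‖∫ θ in (0:ℝ)..1, (∫ t : ℝ, f ((θ : ℂ) - 1 / ((w : ℂ) * ((t : ℂ) + I)))) *
          Complex.exp (-(2 * π * I * k * θ))‖ ≤ M / |(k : ℝ)| ^ 3 := by
  have hfc : Continuous f := hf.continuous
  set fI : ℂ → ℂ := fun z => fderiv ℝ f z I with hfI_def
  have hfI : ContDiff ℝ ∞ fI := contDiff_fderiv_apply hf I
  have hpI : ∀ z, fI (z + 1) = fI z := periodic_fderiv_apply hper I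
  have hsI : ∀ z, fI z ≠ 0 → a ≤ z.im ∧ z.im ≤ b := support_fderiv_apply hsupp I
  obtain ⟨C₀, hC₀0, hC₀⟩ := exists_norm_coeff_le hf hper hsupp
  obtain ⟨C₁, hC₁0, hC₁⟩ := exists_norm_coeff_le hfI hpI hsI
  have hb : 0 < b := lt_of_lt_of_le ha hab
  refine ⟨2 * Real.sqrt (3 * b / a) * C₀ + 6 * (b * C₁ + C₀) / a, by positivity,
    fun w hw k hk => ?_⟩
  rw [coeff_integral_apply_hpt hfc hper hsupp ha hw k]
  have hk' : (0:ℝ) < |(k : ℝ)| := abs_pos.mpr (Int.cast_ne_zero.mpr hk)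
  set G : ℝ → ℂ := fun h => ∫ x in (0:ℝ)..1, f (x + h * I) * Complex.exp (-(2 * π * I * k * x))
    with hG_def
  set G₁ : ℝ → ℂ := fun h => ∫ x in (0:ℝ)..1, fI (x + h * I) * Complex.exp (-(2 * π * I * k * x))
    with hG₁_def
  have hG : ∀ h, HasDerivAt G (G₁ h) h := fun h => hasDerivAt_coeff hf hper hsupp k h
  have hG₁c : Continuous G₁ := continuous_coeff hfI hpI hsI k
  have hS₀ : ∀ h, ‖G h‖ ≤ C₀ / |(k : ℝ)| ^ 3 := fun h => hC₀ h k hk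
  have hS₁ : ∀ h, ‖G₁ h‖ ≤ C₁ / |(k : ℝ)| ^ 3 := fun h => hC₁ h k hk
  have hGs : ∀ h, G h ≠ 0 → a < h ∧ h < b := fun h hh => coeff_support hfc hsupp k h hh
  have hG₁s : ∀ h, G₁ h ≠ 0 → a < h ∧ h < b := fun h hh =>
    coeff_support hfI.continuous hsI k h hh
  change ‖∫ t : ℝ, Complex.exp (2 * π * I * k * (-t / (w * (1 + t ^ 2)))) *
    G (1 / (w * (1 + t ^ 2)))‖ ≤ _
  have h2πk : 1 ≤ 2 * π * |(k : ℝ)| := by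
    have : (1:ℝ) ≤ |(k:ℝ)| := by
      rw [← Int.cast_abs]; exact_mod_cast Int.one_le_abs hk
    nlinarith [Real.pi_gt_three]
  rcases le_or_gt w (1 / (3 * b)) with hwb | hwb
  · refine (norm_phase_integral_le_of_le ha hab hw hwb hk hG hG₁c hS₀ hS₁ hGs hG₁s).trans ?_
    rw [div_le_div_iff₀ (by positivity) (by positivity)]
    have e1 : 6 * (b * (C₁ / |(k:ℝ)| ^ 3) + C₀ / |(k:ℝ)| ^ 3) * |(k:ℝ)| ^ 3 =
        6 * (b * C₁ + C₀) := by
      field_simp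
    rw [e1]
    have h0 : 0 ≤ 2 * Real.sqrt (3 * b / a) * C₀ := by positivity
    calc 6 * (b * C₁ + C₀) = (6 * (b * C₁ + C₀) / a) * (1 * a) := by field_simp
      _ ≤ (2 * Real.sqrt (3 * b / a) * C₀ + 6 * (b * C₁ + C₀) / a) * (2 * π * |(k:ℝ)| * a) :=
        mul_le_mul (by linarith) (by nlinarith) (by positivity) (by positivity)
  · refine (norm_phase_integral_le_of_ge k ha hab hw hwb.le hS₀ hGs).trans ?_
    rw [show 2 * Real.sqrt (3 * b / a) * (C₀ / |(k:ℝ)| ^ 3) =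
      (2 * Real.sqrt (3 * b / a) * C₀) / |(k:ℝ)| ^ 3 by ring]
    gcongr
    have : 0 ≤ 6 * (b * C₁ + C₀) / a := by positivity
    linarith

/-- Summability of the coefficients of `Ψ(w, ·)`. [folklore] -/
theorem summable_coeffPsi (hf : ContDiff ℝ ∞ f) (hper : ∀ z, f (z + 1) = f z)
    (hsupp : ∀ z, f z ≠ 0 → a ≤ z.im ∧ z.im ≤ b) (ha : 0 < a) (hab : a ≤ b) {w : ℝ}
    (hw : 0 < w) :
    Summable fun k : ℤ => ∫ θ in (0:ℝ)..1,
      (∫ t : ℝ, f ((θ : ℂ) - 1 / ((w : ℂ) * ((t : ℂ) + I)))) *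
        Complex.exp (-(2 * π * I * k * θ)) := by
  obtain ⟨M, -, hM⟩ := exists_norm_coeffPsi_le hf hper hsupp ha hab
  exact summable_of_norm_le_div_cube fun k hk => hM w hw k hk

/-- **Fourier expansion of the horocycle integral**: for `w > 0` and every `θ`,
`Ψ(w,θ) = ∑_k (∫₀¹ Ψ(w,·) e(-k·)) e(kθ)`. [folklore] -/
theorem hasSum_integral_apply_hpt (hf : ContDiff ℝ ∞ f) (hper : ∀ z, f (z + 1) = f z)
    (hsupp : ∀ z, f z ≠ 0 → a ≤ z.im ∧ z.im ≤ b) (ha : 0 < a) (hab : a ≤ b) {w : ℝ}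
    (hw : 0 < w) (θ : ℝ) :
    HasSum (fun k : ℤ => (∫ θ' in (0:ℝ)..1,
      (∫ t : ℝ, f ((θ' : ℂ) - 1 / ((w : ℂ) * ((t : ℂ) + I)))) *
        Complex.exp (-(2 * π * I * k * θ'))) * Complex.exp (2 * π * I * k * θ))
      (∫ t : ℝ, f ((θ : ℂ) - 1 / ((w : ℂ) * ((t : ℂ) + I)))) :=
  hasSum_fourier_of_periodic (Φ := fun θ : ℝ => ∫ t : ℝ, f ((θ : ℂ) - 1 / ((w : ℂ) * ((t : ℂ) + I))))
    (continuous_integral_apply_hpt hf.continuous hsupp ha hw)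
    (fun x => integral_apply_hpt_add_one hper w x) (summable_coeffPsi hf hper hsupp ha hab hw) θ

/-- For `w ≥ 1/a` the horocycle integral vanishes identically. [folklore] -/
theorem integral_apply_hpt_eq_zero_of_le (hfc : Continuous f)
    (hsupp : ∀ z, f z ≠ 0 → a ≤ z.im ∧ z.im ≤ b) (ha : 0 < a) {w : ℝ} (hw : 1 / a ≤ w) (θ : ℝ) :
    ∫ t : ℝ, f ((θ : ℂ) - 1 / ((w : ℂ) * ((t : ℂ) + I))) = 0 := by
  simp_rw [apply_hpt_eq_zero_of_le hfc hsupp ha hw θ, integral_zero]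

end HorocyclePhase

end Literature.NumberTheory.LFunctions

end
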